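import Literature.Probability.RandomPlanarGeometry.HexSAWSurfaceWallRenewalEighthFloor
import HarnessLib

/-!
# The eighth-order census identity of the adsorbed honeycomb walk:
# `y⁷ (β(y)² − y − 1/y − 1/y² − 2/y³ − 4/y⁴ − 6/y⁵ − 12/y⁶) → N₉,₁ + N₁₀,₂ + N₁₁,₃ + N₁₂,₄ − 213`

`β(y) = wallRate y` is the exponential growth rate of wall bridges of self-avoiding walks on the brick-wall (hexagonal) lattice along a zigzag wall with
contact fugacity `y` («WALL-BRIDGES»); `N_{s,v} = #{ω ∈ ipwb (2s) : visits = v}` are the class numbers of the wall-renewal census (irreducible positive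
wall bridges by half-length and surface visits).  The tree has `β(y)² = y + 1/y + 1/y² + 2/y³ + 4/y⁴ + 6/y⁵ + 12/y⁶ + o(y⁻⁶)` with every coefficient
EXACT («A6-EXACT» `HexSAWSurfaceWallRenewalSeventhExact`) and the eighth-order floor `≥ 18` («EIGHTH-FLOOR»).  This module proves that the EIGHTH
coefficient EXISTS and identifies it with the diagonal `s − v = 8` of the census, all four class numbers kept SYMBOLIC:

  ★★★ `tendsto_pow_seven_mul_wallRate_sq_sub_census (h₁ : m₁ = 18) (h₂ : m₂ = 20) (h₃ : m₃ = 22) (h₄ : m₄ = 24) :`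
      `y⁷ (β² − y − 1/y − 1/y² − 2/y³ − 4/y⁴ − 6/y⁵ − 12/y⁶) → N₉,₁ + N₁₀,₂ + N₁₁,₃ + N₁₂,₄ − 213`

(`N₉,₁ = #((ipwb m₁).filter (visits m₁ · = 1))`, …; `eq_census_of_tendsto_…` the uniqueness form; `eighteen_le_census_eight` the corollary
`N₉,₁ + N₁₀,₂ + N₁₁,₃ + N₁₂,₄ ≥ 231` from the floor).  Substituting kernel-certified class numbers (this seat's «CENSUS-EIGHT-A»: `N₉,₁ = 98`, `N₁₀,₂ = 99`;
a-idea-1 g35's «SIX-STEP-RIGIDITY»: `N₁₂,₄ = 1`; the `(22,3)` census: `N₁₁,₃ = 33`) turns it into `a₇ = 18`, the lane's prediction of PLAN am.50 — those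
substitutions are one-line corollaries filed after the censuses land; nothing here depends on them.

METHOD («A6-EXACT» one order up, with the census symbolic).  (§1) class polynomials: `N_{n,v}·y^v ≤ Λ_n(y)` and the decompositions `Λ₂₂ ≤ 3²²(y + y²) +
N₁₁,₃y³`, `Λ₂₄ ≤ 3²⁴(y + y² + y³) + N₁₂,₄y⁴`, `Λ₂₆ ≤ 3²⁶(y + y² + y³ + y⁴)` (`visits ≤ n/2 − 8` for `n ≥ 22` and `6·visits ≤ n`: the six-step law, cars 71 /
«SEVENTH-EXACT-MEAN»).  (§2) Kesten's identity `Σ_s f_s = 1` on `y > μ³` («RENEWAL-CUBE-RANGE») at order EIGHT: with the exact laws `f₃ … f₈` (cars 63–72),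
`f₉ = (N₉,₁y + 34y² + y³)/β¹⁸`, `f₁₀ = (N₁₀,₁y + N₁₀,₂y² + 7y³)/β²⁰` («SEVEN-CENSUS») and the six-step tail at `n = 13` («KENDALL-CUBE»:
`1 − Σ_{k ≤ 13} f_k ≤ Aθ₃^{13} ≍ y^{−26/3} = o(y⁻⁸)`), the order-eight head `H₈ = y/β² + … + (N₉,₁y + 34y² + y³)/β¹⁸ + (N₁₀,₂y² + 7y³)/β²⁰ + N₁₁,₃y³/β²² +
N₁₂,₄y⁴/β²⁴` satisfies `1 − Aθ₃^{13} − CRUDE₈ ≤ H₈ ≤ 1` with `CRUDE₈ = 3²⁰y/β²⁰ + 3²²(y + y²)/β²² + 3²⁴(y + y² + y³)/β²⁴ + 3²⁶(y + … + y⁴)/β²⁶ = O(y⁻⁹)`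
(the classes with `s − v ≥ 9` at `s ≤ 13` by `#ipwb_n ≤ 3ⁿ`).  (§3) `y⁷β²(Aθ₃^{13} + CRUDE₈) → 0` (`(y^{2/3})^{13} = y⁸·y^{2/3}`).  (§4) the exact identity
`T − G = y⁷β²(1 − H₈)` for `T = y⁷(β² − y − … − 12/y⁶)` and the comparison function `G(y, r)` (`r = y/β²`; «EIGHTH-FLOOR»'s `G` with the four
diagonal-eight coefficients symbolic) gives `G ≤ T ≤ G + y⁷β²·tail`.  (§5) `G → ΣN − 213`: the numeric part of `G` is an exact polynomial in the `β²`-tower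
`A, Q, P, H, K` and `u = 1/y` (33 monomials, `ring`; orders one to six exact: `A, Q, P → 1`, `H → 2`, `K → 2`) tending to `−213`, and `N·r^s → N`.  (§6) squeeze.

HONEST LABEL.  LANE THEOREM for this model, DERIVED (assembly of the landed census chain cars 63–72, the six-step law, the cube-range renewal toolkit and
the `β²`-tower); the printed sources carry `β ∼ √y` ([BeatonBousquetMelouDeGierDuminilCopinGuttmann2014, §3.1, Proposition 5 and p. 10 (arXiv v5)]) and
the renewal theory ([MadrasSlade1993, §4.2, (4.2.2), (4.2.4), Theorem 4.2.2 (pp. 91–92)], [Kesten1963SAW, §4]) only; the identity and the constant `213`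
are computed in this lane — NEW IN WRITING (modest), not quotations.  Target arithmetic certified beforehand by exact rationals (`HOME/pub-sawmu-a-p6/g20/
m7/cells/tower.py`: `G₈ → 18` with `98/99/33/1`, numeric part `→ −213`; lit-1 g28's face `G₇ = 12 − 213u`).  NOT CLAIMED: the values of the four class
numbers (separate kernel censuses), hence not `a₇ = 18` itself; any rate; anything for `y ≤ μ³`; the armchair wall; numerics.  No definitions.
-/

noncomputable section

namespace Literature.Probability.RandomPlanarGeometry.SAW.HexBW.Wall

open Finset Filter Function
open Literature.Probability.LatticeModels
open _root_.Topology Asymptotics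

variable {y : ℝ} {n : ℕ} {ω : ℕ → Site 2}

/-! ### §0  Private helpers -/

/-- [folklore] Relabel the limit of a `Tendsto` by an equal constant. -/
private theorem tendsto_of_tendsto_of_eq_ci {f : ℝ → ℝ} {L c : ℝ} (h : Tendsto f atTop (𝓝 L)) (e : L = c) :
    Tendsto f atTop (𝓝 c) := e ▸ h

/-- [folklore] `f₁(y) ≤ y/β(y)²` (`f₁ ≤ u₁ ≤ 1` would not do; the class `(1,1)` is the straight walk, so `Λ₂ ≤ y`: copied from
«KESTEN-HEAD-SEVEN»'s private `pwbLaw_one_le_div_khs` via `IPWB ≤ PWB ≤ y` on `pwb 2 = {straight}`). [cite: MadrasSlade1993, §4.2, Theorem 4.2.2(b) (pp. 91–92)] -/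
private theorem pwbLaw_one_le_div_ci (hy : 0 ≤ y) : pwbLaw y 1 ≤ y / wallRate y ^ 2 := by
  classical
  -- `pwb 2 ⊆ {straightWalk 2 2}` exactly as in «KESTEN-HEAD-SEVEN»
  have hsub : pwb 2 ⊆ {Zd.straightWalk 2 2} := by
    intro ω hω
    rw [Finset.mem_singleton]
    obtain ⟨hwbr, hbr⟩ := mem_pwb.1 hω
    obtain ⟨harch, -⟩ := mem_wbr.1 hwbr
    obtain ⟨hhpw, -, h21⟩ := mem_archs.1 harch
    obtain ⟨hsaw, -⟩ := mem_hpw.1 hhpw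
    obtain ⟨h0, hend, hbw, -⟩ := mem_saws_iff.1 hsaw
    have h00 : ω 0 0 = 0 := by simp [h0]
    have h01 : ω 0 1 = 0 := by simp [h0]
    have hs0 : brickWallGraph.Adj (ω 0) (ω 1) := hbw 0 (by norm_num)
    have hs1 : brickWallGraph.Adj (ω 1) (ω 2) := hbw 1 (by norm_num)
    rw [brickWallGraph_adj_coord] at hs0 hs1
    have hb1 : ω 0 0 < ω 1 0 ∧ ω 1 0 ≤ ω 2 0 := hbr 1 le_rfl (by norm_num)
    have h10 : ω 1 0 = 1 := by omega
    have h11 : ω 1 1 = 0 := by omega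
    have h20 : ω 2 0 = 2 := by omega
    funext i
    have hX : ω i 0 = ((min i 2 : ℕ) : ℤ) := by
      rcases Nat.lt_or_ge i 2 with hi | hi
      · interval_cases i
        · simp [h00]
        · simp [h10]
      · rw [hend i hi, min_eq_right hi, h20]; norm_num
    have hY : ω i 1 = 0 := by
      rcases Nat.lt_or_ge i 2 with hi | hi
      · interval_cases i
        · exact h01
        · exact h11
      · rw [hend i hi, h21]
    funext j
    fin_cases j
    · simpa [straightWalk_apply_zero] using hX
    · simpa [straightWalk_apply_one] using hY
  have hv : visits 2 (Zd.straightWalk 2 2) = 1 := (straightWalk_mem_pwb 1).2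
  have hP : PWB 2 y ≤ y := by
    unfold PWB
    calc ∑ ω ∈ pwb 2, y ^ visits 2 ω ≤ ∑ ω ∈ ({Zd.straightWalk 2 2} : Finset (ℕ → Site 2)), y ^ visits 2 ω :=
          Finset.sum_le_sum_of_subset_of_nonneg hsub (fun _ _ _ => pow_nonneg hy _)
      _ = y := by rw [Finset.sum_singleton, hv, pow_one]
  show IPWB 2 y / wallRate y ^ 2 ≤ y / wallRate y ^ 2
  exact div_le_div_of_nonneg_right ((IPWB_le_PWB 2 hy).trans hP) (pow_pos (wallRate_pos y) 2).le

/-- [folklore] A class count is at most `3^n`: `#((ipwb n).filter p) ≤ 3^n`. [cite: MadrasSlade1993, §1.2, (1.2.16) (p. 11)] -/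
private theorem card_filter_ipwb_le_ci (n : ℕ) (p : (ℕ → Site 2) → Prop) [DecidablePred p] :
    (#((ipwb n).filter p) : ℝ) ≤ 3 ^ n :=
  le_trans (by exact_mod_cast Finset.card_filter_le _ _) (card_ipwb_le_three_pow n)

/-- [folklore] `f_k(y) = Λ_{2k}(y)/β(y)^{2k}` with the length as a numeral. [cite: MadrasSlade1993, §4.2, (4.2.2)] -/
private theorem pwbLaw_eq_ci (k : ℕ) {m : ℕ} (hm : m = 2 * k) : pwbLaw y k = IPWB m y / wallRate y ^ m := by
  rw [pwbLaw, hm]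

/-- `y/β² → 1`. [cite: BeatonBousquetMelouDeGierDuminilCopinGuttmann2014, Section 3.1, Proposition 5 (arXiv v5 p. 9)] -/
private theorem tendsto_div_sq_wallRate_ci : Tendsto (fun y : ℝ => y / wallRate y ^ 2) atTop (𝓝 1) := by
  have h1 : Tendsto (fun y : ℝ => ((wallRate y / Real.sqrt y) ^ 2)⁻¹) atTop (𝓝 ((1 : ℝ) ^ 2)⁻¹) :=
    (tendsto_wallRate_div_sqrt.pow 2).inv₀ (by norm_num)
  rw [one_pow, inv_one] at h1
  refine h1.congr' ?_
  filter_upwards [eventually_gt_atTop (0 : ℝ)] with y hy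
  rw [div_pow, Real.sq_sqrt hy.le, inv_div]

/-- `β²/y → 1`. [cite: BeatonBousquetMelouDeGierDuminilCopinGuttmann2014, Section 3.1, Proposition 5 (arXiv v5 p. 9)] -/
private theorem tendsto_sq_wallRate_div_ci : Tendsto (fun y : ℝ => wallRate y ^ 2 / y) atTop (𝓝 1) := by
  have h1 : Tendsto (fun y : ℝ => (wallRate y / Real.sqrt y) ^ 2) atTop (𝓝 ((1 : ℝ) ^ 2)) := tendsto_wallRate_div_sqrt.pow 2
  rw [one_pow] at h1
  refine h1.congr' ?_
  filter_upwards [eventually_gt_atTop (0 : ℝ)] with y hy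
  rw [div_pow, Real.sq_sqrt hy.le]

/-- [folklore] Exponent bookkeeping: `(y^{2/3})^{13} = y⁸ · y^{2/3}` for `y > 0`. -/
private theorem rpow_two_thirds_pow_thirteen_ci (hy : 0 < y) : (y ^ ((2 : ℝ) / 3)) ^ 13 = y ^ 8 * y ^ ((2 : ℝ) / 3) := by
  rw [← Real.rpow_natCast (y ^ ((2 : ℝ) / 3)) 13, ← Real.rpow_mul hy.le, ← Real.rpow_natCast y 8, ← Real.rpow_add hy]
  norm_num

/-! ### §1  Class polynomials: the `v`-visit part of `Λ_n`, and the decompositions of `Λ₂₂`, `Λ₂₄`, `Λ₂₆` -/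

open Classical in
/-- ★ **The `v`-visit class is part of the block polynomial**: `N_{n,v}·y^v ≤ Λ_n(y)` for `y ≥ 0` (`N_{n,v} = #{ω ∈ ipwb n : visits = v}`, symbolic).
[cite: MadrasSlade1993, Section 4.2, (4.2.2) (p. 91)] [cite: Kesten1963SAW, Section 4] -/
theorem card_filter_visits_mul_pow_le_IPWB (n v : ℕ) (hy : 0 ≤ y) :
    (#((ipwb n).filter fun ω => visits n ω = v) : ℝ) * y ^ v ≤ IPWB n y := by
  rw [IPWB, ← Finset.sum_filter_add_sum_filter_not (ipwb n) (fun ω => visits n ω = v)]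
  have h1 : ∑ ω ∈ (ipwb n).filter (fun ω => visits n ω = v), y ^ visits n ω = #((ipwb n).filter fun ω => visits n ω = v) * y ^ v := by
    rw [Finset.sum_congr rfl fun ω hω => by rw [(Finset.mem_filter.1 hω).2], Finset.sum_const, nsmul_eq_mul]
  have h2 : 0 ≤ ∑ ω ∈ (ipwb n).filter (fun ω => ¬ visits n ω = v), y ^ visits n ω :=
    Finset.sum_nonneg fun ω _ => pow_nonneg hy _
  linarith

open Classical in
/-- ★ **`Λ_n(y) ≤ 3^n·(y + … + y^{V−1}) + N_{n,V}·y^V`-type decomposition at length twenty-two**: `Λ₂₂(y) ≤ 3²²(y + y²) + N₁₁,₃·y³` for `y ≥ 0`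
(`1 ≤ visits ≤ 3` on `ipwb 22` by the six-step law). [cite: MadrasSlade1993, Section 4.2, (4.2.2); Section 1.2, (1.2.16) (p. 11)] -/
theorem IPWB_twentytwo_le_census {m : ℕ} (hm : m = 22) (hy : 0 ≤ y) :
    IPWB m y ≤ 3 ^ 22 * (y + y ^ 2) + #((ipwb m).filter fun ω => visits m ω = 3) * y ^ 3 := by
  rw [IPWB, ← Finset.sum_filter_add_sum_filter_not (ipwb m) (fun ω => visits m ω = 3)]
  have h3 : ∑ ω ∈ (ipwb m).filter (fun ω => visits m ω = 3), y ^ visits m ω = #((ipwb m).filter fun ω => visits m ω = 3) * y ^ 3 := by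
    rw [Finset.sum_congr rfl fun ω hω => by rw [(Finset.mem_filter.1 hω).2], Finset.sum_const, nsmul_eq_mul]
  have hrest : ∑ ω ∈ (ipwb m).filter (fun ω => ¬ visits m ω = 3), y ^ visits m ω ≤ 3 ^ 22 * (y + y ^ 2) := by
    have hterm : ∀ ω ∈ (ipwb m).filter (fun ω => ¬ visits m ω = 3), y ^ visits m ω ≤ y + y ^ 2 := by
      intro ω hω
      obtain ⟨hω', hne⟩ := Finset.mem_filter.1 hω
      have h1 := one_le_visits_of_mem_ipwb hω'
      have h8 := visits_le_half_sub_eight (show 22 ≤ m by omega) hω'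
      have hv3 : visits m ω ≤ 2 := by omega
      have hy2 : 0 ≤ y ^ 2 := pow_nonneg hy 2
      rcases Nat.lt_or_ge (visits m ω) 2 with hv | hv
      · rw [show visits m ω = 1 by omega, pow_one]; linarith
      · rw [show visits m ω = 2 by omega]; linarith
    calc ∑ ω ∈ (ipwb m).filter (fun ω => ¬ visits m ω = 3), y ^ visits m ω
        ≤ ∑ _ω ∈ (ipwb m).filter (fun ω => ¬ visits m ω = 3), (y + y ^ 2) := Finset.sum_le_sum hterm
      _ = #((ipwb m).filter fun ω => ¬ visits m ω = 3) * (y + y ^ 2) := by rw [Finset.sum_const, nsmul_eq_mul]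
      _ ≤ 3 ^ m * (y + y ^ 2) := mul_le_mul_of_nonneg_right (card_filter_ipwb_le_ci m _) (by positivity)
      _ = 3 ^ 22 * (y + y ^ 2) := by rw [hm]
  linarith

open Classical in
/-- ★ `Λ₂₄(y) ≤ 3²⁴(y + y² + y³) + N₁₂,₄·y⁴` for `y ≥ 0` (`1 ≤ visits ≤ 4` on `ipwb 24`, six-step law). [cite: MadrasSlade1993, Section 4.2, (4.2.2); Section 1.2, (1.2.16) (p. 11)] -/
theorem IPWB_twentyfour_le_census {m : ℕ} (hm : m = 24) (hy : 0 ≤ y) :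
    IPWB m y ≤ 3 ^ 24 * (y + y ^ 2 + y ^ 3) + #((ipwb m).filter fun ω => visits m ω = 4) * y ^ 4 := by
  rw [IPWB, ← Finset.sum_filter_add_sum_filter_not (ipwb m) (fun ω => visits m ω = 4)]
  have h4 : ∑ ω ∈ (ipwb m).filter (fun ω => visits m ω = 4), y ^ visits m ω = #((ipwb m).filter fun ω => visits m ω = 4) * y ^ 4 := by
    rw [Finset.sum_congr rfl fun ω hω => by rw [(Finset.mem_filter.1 hω).2], Finset.sum_const, nsmul_eq_mul]
  have hrest : ∑ ω ∈ (ipwb m).filter (fun ω => ¬ visits m ω = 4), y ^ visits m ω ≤ 3 ^ 24 * (y + y ^ 2 + y ^ 3) := by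
    have hterm : ∀ ω ∈ (ipwb m).filter (fun ω => ¬ visits m ω = 4), y ^ visits m ω ≤ y + y ^ 2 + y ^ 3 := by
      intro ω hω
      obtain ⟨hω', hne⟩ := Finset.mem_filter.1 hω
      have h1 := one_le_visits_of_mem_ipwb hω'
      have h8 := visits_le_half_sub_eight (show 22 ≤ m by omega) hω'
      have hv4 : visits m ω ≤ 3 := by omega
      have hy2 : 0 ≤ y ^ 2 := pow_nonneg hy 2
      have hy3 : 0 ≤ y ^ 3 := pow_nonneg hy 3
      rcases Nat.lt_or_ge (visits m ω) 2 with hv | hv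
      · rw [show visits m ω = 1 by omega, pow_one]; linarith
      rcases Nat.lt_or_ge (visits m ω) 3 with hv' | hv'
      · rw [show visits m ω = 2 by omega]; linarith
      · rw [show visits m ω = 3 by omega]; linarith
    calc ∑ ω ∈ (ipwb m).filter (fun ω => ¬ visits m ω = 4), y ^ visits m ω
        ≤ ∑ _ω ∈ (ipwb m).filter (fun ω => ¬ visits m ω = 4), (y + y ^ 2 + y ^ 3) := Finset.sum_le_sum hterm
      _ = #((ipwb m).filter fun ω => ¬ visits m ω = 4) * (y + y ^ 2 + y ^ 3) := by rw [Finset.sum_const, nsmul_eq_mul]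
      _ ≤ 3 ^ m * (y + y ^ 2 + y ^ 3) := mul_le_mul_of_nonneg_right (card_filter_ipwb_le_ci m _) (by positivity)
      _ = 3 ^ 24 * (y + y ^ 2 + y ^ 3) := by rw [hm]
  linarith

/-- ★ `Λ₂₆(y) ≤ 3²⁶(y + y² + y³ + y⁴)` for `y ≥ 0` (`1 ≤ visits ≤ 4` on `ipwb 26`: six-step law `6·visits ≤ 26`). [cite: MadrasSlade1993, Section 4.2, (4.2.2); Section 1.2, (1.2.16) (p. 11)] -/
theorem IPWB_twentysix_le {m : ℕ} (hm : m = 26) (hy : 0 ≤ y) : IPWB m y ≤ 3 ^ 26 * (y + y ^ 2 + y ^ 3 + y ^ 4) := by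
  classical
  have hterm : ∀ ω ∈ ipwb m, y ^ visits m ω ≤ y + y ^ 2 + y ^ 3 + y ^ 4 := by
    intro ω hω
    have h1 := one_le_visits_of_mem_ipwb hω
    have h6 := six_mul_visits_le hω (by omega)
    have h4 : visits m ω ≤ 4 := by omega
    have hy2 : 0 ≤ y ^ 2 := pow_nonneg hy 2
    have hy3 : 0 ≤ y ^ 3 := pow_nonneg hy 3
    have hy4 : 0 ≤ y ^ 4 := pow_nonneg hy 4
    rcases Nat.lt_or_ge (visits m ω) 2 with hv | hv
    · rw [show visits m ω = 1 by omega, pow_one]; linarith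
    rcases Nat.lt_or_ge (visits m ω) 3 with hv' | hv'
    · rw [show visits m ω = 2 by omega]; linarith
    rcases Nat.lt_or_ge (visits m ω) 4 with hv'' | hv''
    · rw [show visits m ω = 3 by omega]; linarith
    · rw [show visits m ω = 4 by omega]; linarith
  calc IPWB m y = ∑ ω ∈ ipwb m, y ^ visits m ω := rfl
    _ ≤ ∑ _ω ∈ ipwb m, (y + y ^ 2 + y ^ 3 + y ^ 4) := Finset.sum_le_sum hterm
    _ = #(ipwb m) * (y + y ^ 2 + y ^ 3 + y ^ 4) := by rw [Finset.sum_const, nsmul_eq_mul]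
    _ ≤ 3 ^ m * (y + y ^ 2 + y ^ 3 + y ^ 4) := mul_le_mul_of_nonneg_right (card_ipwb_le_three_pow m) (by positivity)
    _ = 3 ^ 26 * (y + y ^ 2 + y ^ 3 + y ^ 4) := by rw [hm]

/-! ### §2  Kesten's identity at order eight: the head sandwich with symbolic class numbers -/

open Classical in
/-- ★ **The head from above** (`y ≥ 0`): `Σ_{k ≤ 13} f_k(y) ≤ H₈(y) + CRUDE₈(y)`, where
`H₈ = y/β² + y/β⁶ + y/β⁸ + 3y/β¹⁰ + (6y + y²)/β¹² + (15y + 3y²)/β¹⁴ + (38y + 11y²)/β¹⁶ + (N₉,₁y + 34y² + y³)/β¹⁸ + (N₁₀,₂y² + 7y³)/β²⁰ + N₁₁,₃y³/β²² + N₁₂,₄y⁴/β²⁴`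
(all four diagonal-eight class numbers SYMBOLIC) and `CRUDE₈ = 3²⁰y/β²⁰ + 3²²(y + y²)/β²² + 3²⁴(y + y² + y³)/β²⁴ + 3²⁶(y + y² + y³ + y⁴)/β²⁶`.
[cite: MadrasSlade1993, §4.2, (4.2.2), (4.2.4) (p. 91)] -/
theorem sum_pwbLaw_range_fourteen_le {m₁ m₂ m₃ m₄ : ℕ} (h₁ : m₁ = 18) (h₂ : m₂ = 20) (h₃ : m₃ = 22) (h₄ : m₄ = 24) (hy : 0 ≤ y) :
    ∑ k ∈ range 14, pwbLaw y k ≤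
      (y / wallRate y ^ 2 + y / wallRate y ^ 6 + y / wallRate y ^ 8 + 3 * y / wallRate y ^ 10 +
        (6 * y + y ^ 2) / wallRate y ^ 12 + (15 * y + 3 * y ^ 2) / wallRate y ^ 14 + (38 * y + 11 * y ^ 2) / wallRate y ^ 16 +
        (#((ipwb m₁).filter fun ω => visits m₁ ω = 1) * y + 34 * y ^ 2 + y ^ 3) / wallRate y ^ 18 +
        (#((ipwb m₂).filter fun ω => visits m₂ ω = 2) * y ^ 2 + 7 * y ^ 3) / wallRate y ^ 20 +
        #((ipwb m₃).filter fun ω => visits m₃ ω = 3) * y ^ 3 / wallRate y ^ 22 +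
        #((ipwb m₄).filter fun ω => visits m₄ ω = 4) * y ^ 4 / wallRate y ^ 24) +
      (3 ^ 20 * y / wallRate y ^ 20 + 3 ^ 22 * (y + y ^ 2) / wallRate y ^ 22 + 3 ^ 24 * (y + y ^ 2 + y ^ 3) / wallRate y ^ 24 +
        3 ^ 26 * (y + y ^ 2 + y ^ 3 + y ^ 4) / wallRate y ^ 26) := by
  subst h₁ h₂ h₃ h₄
  have hβ := wallRate_pos y
  have e0 : pwbLaw y 0 = 0 := pwbLaw_zero
  have e2 : pwbLaw y 2 = 0 := by rw [pwbLaw_eq_ci 2 (m := 4) rfl, IPWB_four rfl, zero_div]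
  have e3 : pwbLaw y 3 = y / wallRate y ^ 6 := by rw [pwbLaw_eq_ci 3 (m := 6) rfl, IPWB_six rfl]
  have e4 : pwbLaw y 4 = y / wallRate y ^ 8 := by rw [pwbLaw_eq_ci 4 (m := 8) rfl, IPWB_eight_eq rfl]
  have e5 : pwbLaw y 5 = 3 * y / wallRate y ^ 10 := by rw [pwbLaw_eq_ci 5 (m := 10) rfl, IPWB_ten_eq rfl]
  have e6 : pwbLaw y 6 = (6 * y + y ^ 2) / wallRate y ^ 12 := by rw [pwbLaw_eq_ci 6 (m := 12) rfl, IPWB_twelve_eq_six rfl]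
  have e7 : pwbLaw y 7 = (15 * y + 3 * y ^ 2) / wallRate y ^ 14 := by rw [pwbLaw_eq_ci 7 (m := 14) rfl, IPWB_fourteen_eq_fifteen rfl]
  have e8 : pwbLaw y 8 = (38 * y + 11 * y ^ 2) / wallRate y ^ 16 := by rw [pwbLaw_eq_ci 8 (m := 16) rfl, IPWB_sixteen_eq_thirtyEight rfl]
  have e9 : pwbLaw y 9 = (#((ipwb 18).filter fun ω => visits 18 ω = 1) * y + 34 * y ^ 2 + y ^ 3) / wallRate y ^ 18 := by
    rw [pwbLaw_eq_ci 9 (m := 18) rfl, IPWB_eighteen_eq rfl]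
  have e10 : pwbLaw y 10 ≤ (#((ipwb 20).filter fun ω => visits 20 ω = 2) * y ^ 2 + 7 * y ^ 3) / wallRate y ^ 20 + 3 ^ 20 * y / wallRate y ^ 20 := by
    rw [pwbLaw_eq_ci 10 (m := 20) rfl, IPWB_twenty_eq rfl, ← add_div]
    refine div_le_div_of_nonneg_right ?_ (pow_pos hβ 20).le
    have hN := mul_le_mul_of_nonneg_right (card_filter_ipwb_le_ci 20 (fun ω => visits 20 ω = 1)) hy
    linarith
  have e11 : pwbLaw y 11 ≤ #((ipwb 22).filter fun ω => visits 22 ω = 3) * y ^ 3 / wallRate y ^ 22 + 3 ^ 22 * (y + y ^ 2) / wallRate y ^ 22 := by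
    rw [pwbLaw_eq_ci 11 (m := 22) rfl, ← add_div]
    refine div_le_div_of_nonneg_right ?_ (pow_pos hβ 22).le
    have h := IPWB_twentytwo_le_census (m := 22) rfl hy
    linarith
  have e12 : pwbLaw y 12 ≤ #((ipwb 24).filter fun ω => visits 24 ω = 4) * y ^ 4 / wallRate y ^ 24 + 3 ^ 24 * (y + y ^ 2 + y ^ 3) / wallRate y ^ 24 := by
    rw [pwbLaw_eq_ci 12 (m := 24) rfl, ← add_div]
    refine div_le_div_of_nonneg_right ?_ (pow_pos hβ 24).le
    have h := IPWB_twentyfour_le_census (m := 24) rfl hy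
    linarith
  have e13 : pwbLaw y 13 ≤ 3 ^ 26 * (y + y ^ 2 + y ^ 3 + y ^ 4) / wallRate y ^ 26 := by
    rw [pwbLaw_eq_ci 13 (m := 26) rfl]
    exact div_le_div_of_nonneg_right (IPWB_twentysix_le rfl hy) (pow_pos hβ 26).le
  have e1 := pwbLaw_one_le_div_ci hy
  simp only [Finset.sum_range_succ, Finset.sum_range_zero, e0, e2, e3, e4, e5, e6, e7, e8, e9]
  linarith

open Classical in
/-- ★ **The head from below** (`y > 0`): `H₈(y) ≤ Σ_{k ≤ 13} f_k(y)` (symbolic class numbers; the one-visit twenties, the `≤ 2`-visit twenty-twos,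
the `≤ 3`-visit twenty-fours and the whole block `k = 13` dropped; `y/β² ≤ f₁`). [cite: MadrasSlade1993, §4.2, (4.2.2), (4.2.4) (p. 91)] -/
theorem head_le_sum_pwbLaw_range_fourteen {m₁ m₂ m₃ m₄ : ℕ} (h₁ : m₁ = 18) (h₂ : m₂ = 20) (h₃ : m₃ = 22) (h₄ : m₄ = 24) (hy : 0 < y) :
    y / wallRate y ^ 2 + y / wallRate y ^ 6 + y / wallRate y ^ 8 + 3 * y / wallRate y ^ 10 +
        (6 * y + y ^ 2) / wallRate y ^ 12 + (15 * y + 3 * y ^ 2) / wallRate y ^ 14 + (38 * y + 11 * y ^ 2) / wallRate y ^ 16 +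
        (#((ipwb m₁).filter fun ω => visits m₁ ω = 1) * y + 34 * y ^ 2 + y ^ 3) / wallRate y ^ 18 +
        (#((ipwb m₂).filter fun ω => visits m₂ ω = 2) * y ^ 2 + 7 * y ^ 3) / wallRate y ^ 20 +
        #((ipwb m₃).filter fun ω => visits m₃ ω = 3) * y ^ 3 / wallRate y ^ 22 +
        #((ipwb m₄).filter fun ω => visits m₄ ω = 4) * y ^ 4 / wallRate y ^ 24 ≤
      ∑ k ∈ range 14, pwbLaw y k := by
  subst h₁ h₂ h₃ h₄
  have hβ := wallRate_pos y
  have e0 : pwbLaw y 0 = 0 := pwbLaw_zero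
  have e2 : pwbLaw y 2 = 0 := by rw [pwbLaw_eq_ci 2 (m := 4) rfl, IPWB_four rfl, zero_div]
  have e3 : pwbLaw y 3 = y / wallRate y ^ 6 := by rw [pwbLaw_eq_ci 3 (m := 6) rfl, IPWB_six rfl]
  have e4 : pwbLaw y 4 = y / wallRate y ^ 8 := by rw [pwbLaw_eq_ci 4 (m := 8) rfl, IPWB_eight_eq rfl]
  have e5 : pwbLaw y 5 = 3 * y / wallRate y ^ 10 := by rw [pwbLaw_eq_ci 5 (m := 10) rfl, IPWB_ten_eq rfl]
  have e6 : pwbLaw y 6 = (6 * y + y ^ 2) / wallRate y ^ 12 := by rw [pwbLaw_eq_ci 6 (m := 12) rfl, IPWB_twelve_eq_six rfl]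
  have e7 : pwbLaw y 7 = (15 * y + 3 * y ^ 2) / wallRate y ^ 14 := by rw [pwbLaw_eq_ci 7 (m := 14) rfl, IPWB_fourteen_eq_fifteen rfl]
  have e8 : pwbLaw y 8 = (38 * y + 11 * y ^ 2) / wallRate y ^ 16 := by rw [pwbLaw_eq_ci 8 (m := 16) rfl, IPWB_sixteen_eq_thirtyEight rfl]
  have e9 : pwbLaw y 9 = (#((ipwb 18).filter fun ω => visits 18 ω = 1) * y + 34 * y ^ 2 + y ^ 3) / wallRate y ^ 18 := by
    rw [pwbLaw_eq_ci 9 (m := 18) rfl, IPWB_eighteen_eq rfl]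
  have e10 : (#((ipwb 20).filter fun ω => visits 20 ω = 2) * y ^ 2 + 7 * y ^ 3) / wallRate y ^ 20 ≤ pwbLaw y 10 := by
    rw [pwbLaw_eq_ci 10 (m := 20) rfl, IPWB_twenty_eq rfl]
    refine div_le_div_of_nonneg_right ?_ (pow_pos hβ 20).le
    have hN : (0 : ℝ) ≤ #((ipwb 20).filter fun ω => visits 20 ω = 1) * y := mul_nonneg (Nat.cast_nonneg _) hy.le
    linarith
  have e11 : #((ipwb 22).filter fun ω => visits 22 ω = 3) * y ^ 3 / wallRate y ^ 22 ≤ pwbLaw y 11 := by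
    rw [pwbLaw_eq_ci 11 (m := 22) rfl]
    exact div_le_div_of_nonneg_right (card_filter_visits_mul_pow_le_IPWB 22 3 hy.le) (pow_pos hβ 22).le
  have e12 : #((ipwb 24).filter fun ω => visits 24 ω = 4) * y ^ 4 / wallRate y ^ 24 ≤ pwbLaw y 12 := by
    rw [pwbLaw_eq_ci 12 (m := 24) rfl]
    exact div_le_div_of_nonneg_right (card_filter_visits_mul_pow_le_IPWB 24 4 hy.le) (pow_pos hβ 24).le
  have e13 : 0 ≤ pwbLaw y 13 := pwbLaw_nonneg hy.le 13
  have e1 := div_sq_wallRate_le_pwbLaw_one hy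
  simp only [Finset.sum_range_succ, Finset.sum_range_zero, e0, e2, e3, e4, e5, e6, e7, e8, e9]
  linarith

/-- `Σ_{k ≤ n} f_k(y) ≤ 1` for `y > μ³` (partial sums of Kesten's identity). [cite: MadrasSlade1993, §4.2, (4.2.4), Theorem 4.2.2 (pp. 91–92)] -/
private theorem sum_pwbLaw_range_le_one_ci (hy : hexConnectiveConstant ^ 3 < y) (n : ℕ) :
    ∑ k ∈ range n, pwbLaw y k ≤ 1 := by
  have hμ := hexConnectiveConstant_pos
  have hy0 : 0 < y := lt_of_le_of_lt (by positivity) hy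
  exact sum_le_hasSum (range n) (fun k _ => pwbLaw_nonneg hy0.le k) (hasSum_pwbLaw_of_cube_lt hy)

open Classical in
/-- ★★ **The order-eight head sandwich** for `y > μ³` (symbolic diagonal-eight class numbers):
`1 − Aθ₃^{13} − CRUDE₈(y) ≤ H₈(y) ≤ 1`, `θ₃ = μ²/y^{2/3}`, `A = (μ² + y^{2/3}/μ²)θ₃/(1 − θ₃)` — the tail at `n = 13` is `≍ y^{−26/3} = o(y⁻⁸)` and every
crude term is `O(y⁻⁹)`, so the inversion of this inequality in `β²` pins the eighth coefficient.
[cite: MadrasSlade1993, §4.2, (4.2.2), (4.2.4), Theorem 4.2.2 (pp. 91–92)] [cite: Kesten1963SAW, §4] -/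
theorem kesten_head_eight_sandwich_of_cube_lt {m₁ m₂ m₃ m₄ : ℕ} (h₁ : m₁ = 18) (h₂ : m₂ = 20) (h₃ : m₃ = 22) (h₄ : m₄ = 24)
    (hy : hexConnectiveConstant ^ 3 < y) :
    1 - (hexConnectiveConstant ^ 2 + y ^ ((2 : ℝ) / 3) / hexConnectiveConstant ^ 2) *
          (hexConnectiveConstant ^ 2 / y ^ ((2 : ℝ) / 3)) / (1 - hexConnectiveConstant ^ 2 / y ^ ((2 : ℝ) / 3)) *
          (hexConnectiveConstant ^ 2 / y ^ ((2 : ℝ) / 3)) ^ 13 -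
        (3 ^ 20 * y / wallRate y ^ 20 + 3 ^ 22 * (y + y ^ 2) / wallRate y ^ 22 + 3 ^ 24 * (y + y ^ 2 + y ^ 3) / wallRate y ^ 24 +
          3 ^ 26 * (y + y ^ 2 + y ^ 3 + y ^ 4) / wallRate y ^ 26) ≤
      y / wallRate y ^ 2 + y / wallRate y ^ 6 + y / wallRate y ^ 8 + 3 * y / wallRate y ^ 10 +
        (6 * y + y ^ 2) / wallRate y ^ 12 + (15 * y + 3 * y ^ 2) / wallRate y ^ 14 + (38 * y + 11 * y ^ 2) / wallRate y ^ 16 +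
        (#((ipwb m₁).filter fun ω => visits m₁ ω = 1) * y + 34 * y ^ 2 + y ^ 3) / wallRate y ^ 18 +
        (#((ipwb m₂).filter fun ω => visits m₂ ω = 2) * y ^ 2 + 7 * y ^ 3) / wallRate y ^ 20 +
        #((ipwb m₃).filter fun ω => visits m₃ ω = 3) * y ^ 3 / wallRate y ^ 22 +
        #((ipwb m₄).filter fun ω => visits m₄ ω = 4) * y ^ 4 / wallRate y ^ 24 ∧
    y / wallRate y ^ 2 + y / wallRate y ^ 6 + y / wallRate y ^ 8 + 3 * y / wallRate y ^ 10 +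
        (6 * y + y ^ 2) / wallRate y ^ 12 + (15 * y + 3 * y ^ 2) / wallRate y ^ 14 + (38 * y + 11 * y ^ 2) / wallRate y ^ 16 +
        (#((ipwb m₁).filter fun ω => visits m₁ ω = 1) * y + 34 * y ^ 2 + y ^ 3) / wallRate y ^ 18 +
        (#((ipwb m₂).filter fun ω => visits m₂ ω = 2) * y ^ 2 + 7 * y ^ 3) / wallRate y ^ 20 +
        #((ipwb m₃).filter fun ω => visits m₃ ω = 3) * y ^ 3 / wallRate y ^ 22 +
        #((ipwb m₄).filter fun ω => visits m₄ ω = 4) * y ^ 4 / wallRate y ^ 24 ≤ 1 := by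
  have hμ := hexConnectiveConstant_pos
  have hy0 : 0 < y := lt_of_le_of_lt (by positivity) hy
  have htail := one_sub_sum_pwbLaw_le_of_cube_lt hy 13
  have hup := sum_pwbLaw_range_fourteen_le h₁ h₂ h₃ h₄ hy0.le
  have hlow := head_le_sum_pwbLaw_range_fourteen h₁ h₂ h₃ h₄ hy0
  have hone := sum_pwbLaw_range_le_one_ci hy 14
  constructor
  · linarith
  · linarith


/-! ### §3  The tail is negligible at order eight: `y⁷ β² (Aθ₃^{13} + CRUDE₈) → 0` -/

/-- ★ The envelope part: `y⁸ · Aθ₃^{13} → 0` (`= μ^{26} · (1 + μ⁴/y^{2/3})/(1 − μ²/y^{2/3}) · y^{−2/3}`). [cite: MadrasSlade1993, Section 4.2, remark before (4.2.21) (p. 94)] -/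
theorem tendsto_pow_eight_mul_envelope_tail :
    Tendsto (fun y : ℝ => y ^ 8 *
      ((hexConnectiveConstant ^ 2 + y ^ ((2 : ℝ) / 3) / hexConnectiveConstant ^ 2) *
          (hexConnectiveConstant ^ 2 / y ^ ((2 : ℝ) / 3)) / (1 - hexConnectiveConstant ^ 2 / y ^ ((2 : ℝ) / 3)) *
          (hexConnectiveConstant ^ 2 / y ^ ((2 : ℝ) / 3)) ^ 13)) atTop (𝓝 0) := by
  have hμ := hexConnectiveConstant_pos
  have hs : Tendsto (fun y : ℝ => y ^ ((2 : ℝ) / 3)) atTop atTop := tendsto_rpow_atTop (by norm_num)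
  have hc : Tendsto (fun y : ℝ => (y ^ ((2 : ℝ) / 3))⁻¹) atTop (𝓝 0) := hs.inv_tendsto_atTop
  have hA : Tendsto (fun y : ℝ => (hexConnectiveConstant ^ 4 / y ^ ((2 : ℝ) / 3) + 1) /
      (1 - hexConnectiveConstant ^ 2 / y ^ ((2 : ℝ) / 3))) atTop (𝓝 ((0 + 1) / (1 - 0))) :=
    ((tendsto_const_nhds.div_atTop hs).add tendsto_const_nhds).div
      (tendsto_const_nhds.sub (tendsto_const_nhds.div_atTop hs)) (by norm_num)
  have h := (hA.const_mul (hexConnectiveConstant ^ 26)).mul hc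
  rw [show hexConnectiveConstant ^ 26 * ((0 + 1) / (1 - 0)) * (0 : ℝ) = 0 by ring] at h
  refine h.congr' ?_
  filter_upwards [eventually_gt_atTop (hexConnectiveConstant ^ 3)] with y hy
  have hy0 : 0 < y := lt_of_le_of_lt (by positivity) hy
  have hs0 : 0 < y ^ ((2 : ℝ) / 3) := Real.rpow_pos_of_pos hy0 _
  have hθ := theta_cube_lt_one hy
  have hD : 1 - hexConnectiveConstant ^ 2 / y ^ ((2 : ℝ) / 3) ≠ 0 := by linarith
  have hD' : y ^ ((2 : ℝ) / 3) - hexConnectiveConstant ^ 2 ≠ 0 := by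
    intro h0
    apply hD
    rw [sub_eq_zero] at h0
    rw [← h0, div_self hs0.ne', sub_self]
  rw [div_pow, ← pow_mul, show 2 * 13 = 26 by norm_num, rpow_two_thirds_pow_thirteen_ci hy0]
  field_simp

/-- ★ The crude-count part: `y⁸ · CRUDE₈(y) → 0` (`CRUDE₈ = 3²⁰y/β²⁰ + 3²²(y + y²)/β²² + 3²⁴(y + y² + y³)/β²⁴ + 3²⁶(y + y² + y³ + y⁴)/β²⁶`; with `r = y/β² → 1`
and `u = 1/y` the product is `3²⁰r¹⁰u + 3²²r¹¹(u² + u) + 3²⁴r¹²(u³ + u² + u) + 3²⁶r¹³(u⁴ + u³ + u² + u)`).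
[cite: BeatonBousquetMelouDeGierDuminilCopinGuttmann2014, Section 3.1, Proposition 5 (arXiv v5 p. 9)] -/
theorem tendsto_pow_eight_mul_crude_tail :
    Tendsto (fun y : ℝ => y ^ 8 * (3 ^ 20 * y / wallRate y ^ 20 + 3 ^ 22 * (y + y ^ 2) / wallRate y ^ 22 +
      3 ^ 24 * (y + y ^ 2 + y ^ 3) / wallRate y ^ 24 + 3 ^ 26 * (y + y ^ 2 + y ^ 3 + y ^ 4) / wallRate y ^ 26)) atTop (𝓝 0) := by
  have hr := tendsto_div_sq_wallRate_ci
  have hu : Tendsto (fun y : ℝ => y⁻¹) atTop (𝓝 0) := tendsto_inv_atTop_zero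
  have h := (((((hr.pow 10).const_mul ((3 : ℝ) ^ 20)).mul hu).add
    (((hr.pow 11).const_mul ((3 : ℝ) ^ 22)).mul ((hu.pow 2).add hu))).add
    (((hr.pow 12).const_mul ((3 : ℝ) ^ 24)).mul (((hu.pow 3).add (hu.pow 2)).add hu))).add
    (((hr.pow 13).const_mul ((3 : ℝ) ^ 26)).mul ((((hu.pow 4).add (hu.pow 3)).add (hu.pow 2)).add hu))
  refine Tendsto.congr' ?_ (tendsto_of_tendsto_of_eq_ci h (by norm_num))
  filter_upwards [eventually_gt_atTop (0 : ℝ)] with y hy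
  have hB : wallRate y ≠ 0 := (wallRate_pos y).ne'
  have hy' : y ≠ 0 := hy.ne'
  field_simp

/-- ★★ **The whole tail is negligible at order eight**: `y⁷ β(y)² (Aθ₃^{13} + CRUDE₈(y)) → 0` (`= (β²/y) · y⁸(…)`, `β²/y → 1`).
[cite: MadrasSlade1993, Section 4.2, Theorem 4.2.2 (pp. 91–92)] -/
theorem tendsto_pow_seven_mul_sq_wallRate_mul_tail_eight :
    Tendsto (fun y : ℝ => y ^ 7 * wallRate y ^ 2 *
      ((hexConnectiveConstant ^ 2 + y ^ ((2 : ℝ) / 3) / hexConnectiveConstant ^ 2) *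
            (hexConnectiveConstant ^ 2 / y ^ ((2 : ℝ) / 3)) / (1 - hexConnectiveConstant ^ 2 / y ^ ((2 : ℝ) / 3)) *
            (hexConnectiveConstant ^ 2 / y ^ ((2 : ℝ) / 3)) ^ 13 +
        (3 ^ 20 * y / wallRate y ^ 20 + 3 ^ 22 * (y + y ^ 2) / wallRate y ^ 22 + 3 ^ 24 * (y + y ^ 2 + y ^ 3) / wallRate y ^ 24 +
          3 ^ 26 * (y + y ^ 2 + y ^ 3 + y ^ 4) / wallRate y ^ 26))) atTop (𝓝 0) := by
  have h := tendsto_sq_wallRate_div_ci.mul (tendsto_pow_eight_mul_envelope_tail.add tendsto_pow_eight_mul_crude_tail)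
  rw [add_zero, mul_zero] at h
  refine h.congr' ?_
  filter_upwards [eventually_gt_atTop (0 : ℝ)] with y hy
  have hy' : y ≠ 0 := hy.ne'
  field_simp

/-! ### §4  The two-sided closed form on `y > μ³` -/

open Classical in
/-- ★★ **The order-eight two-sided closed form.**  For `y > μ³`, with `r = y/β(y)²`, `T(y) := y⁷(β² − y − 1/y − 1/y² − 2/y³ − 4/y⁴ − 6/y⁵ − 12/y⁶)` and
`G(y, r) := y⁶(r² − 1) + y⁵(r³ − 1) + y⁴(3r⁴ + r⁵ − 2) + y³(6r⁵ + 3r⁶ − 4) + y²(15r⁶ + 11r⁷ + r⁸ − 6) + y(38r⁷ + 34r⁸ + 7r⁹ − 12) + (N₉,₁r⁸ + N₁₀,₂r⁹ + N₁₁,₃r¹⁰ + N₁₂,₄r¹¹)`: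
`G(y, r) ≤ T(y) ≤ G(y, r) + y⁷ β² (Aθ₃^{13} + CRUDE₈(y))` — both sides from the exact identity `T − G = y⁷β²(1 − H₈)` and the sandwich of §2.
[cite: Kesten1963SAW, Section 4] [cite: MadrasSlade1993, Section 4.2, (4.2.2), (4.2.4), Theorem 4.2.2 (pp. 91–92)] -/
theorem eighth_order_two_sided_of_cube_lt {m₁ m₂ m₃ m₄ : ℕ} (h₁ : m₁ = 18) (h₂ : m₂ = 20) (h₃ : m₃ = 22) (h₄ : m₄ = 24)
    (hy : hexConnectiveConstant ^ 3 < y) :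
    y ^ 6 * ((y / wallRate y ^ 2) ^ 2 - 1) + y ^ 5 * ((y / wallRate y ^ 2) ^ 3 - 1) +
        y ^ 4 * (3 * (y / wallRate y ^ 2) ^ 4 + (y / wallRate y ^ 2) ^ 5 - 2) +
        y ^ 3 * (6 * (y / wallRate y ^ 2) ^ 5 + 3 * (y / wallRate y ^ 2) ^ 6 - 4) +
        y ^ 2 * (15 * (y / wallRate y ^ 2) ^ 6 + 11 * (y / wallRate y ^ 2) ^ 7 + (y / wallRate y ^ 2) ^ 8 - 6) +
        y * (38 * (y / wallRate y ^ 2) ^ 7 + 34 * (y / wallRate y ^ 2) ^ 8 + 7 * (y / wallRate y ^ 2) ^ 9 - 12) +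
        (#((ipwb m₁).filter fun ω => visits m₁ ω = 1) * (y / wallRate y ^ 2) ^ 8 +
          #((ipwb m₂).filter fun ω => visits m₂ ω = 2) * (y / wallRate y ^ 2) ^ 9 +
          #((ipwb m₃).filter fun ω => visits m₃ ω = 3) * (y / wallRate y ^ 2) ^ 10 +
          #((ipwb m₄).filter fun ω => visits m₄ ω = 4) * (y / wallRate y ^ 2) ^ 11) ≤
      y ^ 7 * (wallRate y ^ 2 - y - 1 / y - 1 / y ^ 2 - 2 / y ^ 3 - 4 / y ^ 4 - 6 / y ^ 5 - 12 / y ^ 6) ∧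
    y ^ 7 * (wallRate y ^ 2 - y - 1 / y - 1 / y ^ 2 - 2 / y ^ 3 - 4 / y ^ 4 - 6 / y ^ 5 - 12 / y ^ 6) ≤
      (y ^ 6 * ((y / wallRate y ^ 2) ^ 2 - 1) + y ^ 5 * ((y / wallRate y ^ 2) ^ 3 - 1) +
        y ^ 4 * (3 * (y / wallRate y ^ 2) ^ 4 + (y / wallRate y ^ 2) ^ 5 - 2) +
        y ^ 3 * (6 * (y / wallRate y ^ 2) ^ 5 + 3 * (y / wallRate y ^ 2) ^ 6 - 4) +
        y ^ 2 * (15 * (y / wallRate y ^ 2) ^ 6 + 11 * (y / wallRate y ^ 2) ^ 7 + (y / wallRate y ^ 2) ^ 8 - 6) +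
        y * (38 * (y / wallRate y ^ 2) ^ 7 + 34 * (y / wallRate y ^ 2) ^ 8 + 7 * (y / wallRate y ^ 2) ^ 9 - 12) +
        (#((ipwb m₁).filter fun ω => visits m₁ ω = 1) * (y / wallRate y ^ 2) ^ 8 +
          #((ipwb m₂).filter fun ω => visits m₂ ω = 2) * (y / wallRate y ^ 2) ^ 9 +
          #((ipwb m₃).filter fun ω => visits m₃ ω = 3) * (y / wallRate y ^ 2) ^ 10 +
          #((ipwb m₄).filter fun ω => visits m₄ ω = 4) * (y / wallRate y ^ 2) ^ 11)) +
      y ^ 7 * wallRate y ^ 2 *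
        ((hexConnectiveConstant ^ 2 + y ^ ((2 : ℝ) / 3) / hexConnectiveConstant ^ 2) *
              (hexConnectiveConstant ^ 2 / y ^ ((2 : ℝ) / 3)) / (1 - hexConnectiveConstant ^ 2 / y ^ ((2 : ℝ) / 3)) *
              (hexConnectiveConstant ^ 2 / y ^ ((2 : ℝ) / 3)) ^ 13 +
          (3 ^ 20 * y / wallRate y ^ 20 + 3 ^ 22 * (y + y ^ 2) / wallRate y ^ 22 + 3 ^ 24 * (y + y ^ 2 + y ^ 3) / wallRate y ^ 24 +
            3 ^ 26 * (y + y ^ 2 + y ^ 3 + y ^ 4) / wallRate y ^ 26)) := by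
  have hμ := hexConnectiveConstant_pos
  have hy0 : 0 < y := lt_of_le_of_lt (by positivity) hy
  have hβ := wallRate_pos y
  have hB : wallRate y ≠ 0 := hβ.ne'
  obtain ⟨hlow, hone⟩ := kesten_head_eight_sandwich_of_cube_lt h₁ h₂ h₃ h₄ hy
  set N₁ := (#((ipwb m₁).filter fun ω => visits m₁ ω = 1) : ℝ) with hN₁
  set N₂ := (#((ipwb m₂).filter fun ω => visits m₂ ω = 2) : ℝ) with hN₂
  set N₃ := (#((ipwb m₃).filter fun ω => visits m₃ ω = 3) : ℝ) with hN₃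
  set N₄ := (#((ipwb m₄).filter fun ω => visits m₄ ω = 4) : ℝ) with hN₄
  set a := (hexConnectiveConstant ^ 2 + y ^ ((2 : ℝ) / 3) / hexConnectiveConstant ^ 2) *
      (hexConnectiveConstant ^ 2 / y ^ ((2 : ℝ) / 3)) / (1 - hexConnectiveConstant ^ 2 / y ^ ((2 : ℝ) / 3)) *
      (hexConnectiveConstant ^ 2 / y ^ ((2 : ℝ) / 3)) ^ 13 with ha
  set b := 3 ^ 20 * y / wallRate y ^ 20 + 3 ^ 22 * (y + y ^ 2) / wallRate y ^ 22 + 3 ^ 24 * (y + y ^ 2 + y ^ 3) / wallRate y ^ 24 +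
      3 ^ 26 * (y + y ^ 2 + y ^ 3 + y ^ 4) / wallRate y ^ 26 with hb
  set K := y / wallRate y ^ 2 + y / wallRate y ^ 6 + y / wallRate y ^ 8 + 3 * y / wallRate y ^ 10 +
      (6 * y + y ^ 2) / wallRate y ^ 12 + (15 * y + 3 * y ^ 2) / wallRate y ^ 14 + (38 * y + 11 * y ^ 2) / wallRate y ^ 16 +
      (N₁ * y + 34 * y ^ 2 + y ^ 3) / wallRate y ^ 18 + (N₂ * y ^ 2 + 7 * y ^ 3) / wallRate y ^ 20 + N₃ * y ^ 3 / wallRate y ^ 22 +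
      N₄ * y ^ 4 / wallRate y ^ 24 with hK
  have key : y ^ 7 * (wallRate y ^ 2 - y - 1 / y - 1 / y ^ 2 - 2 / y ^ 3 - 4 / y ^ 4 - 6 / y ^ 5 - 12 / y ^ 6) -
      (y ^ 6 * ((y / wallRate y ^ 2) ^ 2 - 1) + y ^ 5 * ((y / wallRate y ^ 2) ^ 3 - 1) +
        y ^ 4 * (3 * (y / wallRate y ^ 2) ^ 4 + (y / wallRate y ^ 2) ^ 5 - 2) +
        y ^ 3 * (6 * (y / wallRate y ^ 2) ^ 5 + 3 * (y / wallRate y ^ 2) ^ 6 - 4) +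
        y ^ 2 * (15 * (y / wallRate y ^ 2) ^ 6 + 11 * (y / wallRate y ^ 2) ^ 7 + (y / wallRate y ^ 2) ^ 8 - 6) +
        y * (38 * (y / wallRate y ^ 2) ^ 7 + 34 * (y / wallRate y ^ 2) ^ 8 + 7 * (y / wallRate y ^ 2) ^ 9 - 12) +
        (N₁ * (y / wallRate y ^ 2) ^ 8 + N₂ * (y / wallRate y ^ 2) ^ 9 + N₃ * (y / wallRate y ^ 2) ^ 10 + N₄ * (y / wallRate y ^ 2) ^ 11)) =
      y ^ 7 * wallRate y ^ 2 * (1 - K) := by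
    rw [hK]
    field_simp
    ring
  have hpos : 0 ≤ y ^ 7 * wallRate y ^ 2 := by positivity
  have h0 : 0 ≤ y ^ 7 * wallRate y ^ 2 * (1 - K) := mul_nonneg hpos (sub_nonneg.2 hone)
  have h1 : 1 - K ≤ a + b := by linarith
  have h2 : y ^ 7 * wallRate y ^ 2 * (1 - K) ≤ y ^ 7 * wallRate y ^ 2 * (a + b) := mul_le_mul_of_nonneg_left h1 hpos
  constructor
  · linarith
  · linarith

/-! ### §5  The limit of the comparison function: `G(y, r) → N₉,₁ + N₁₀,₂ + N₁₁,₃ + N₁₂,₄ − 213` -/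

open Classical in
/-- ★★ **The comparison function tends to the diagonal-eight census minus 213**: its numeric part is an exact polynomial in the `β²`-tower
`A, Q, P, H, K` and `u = 1/y` (33 monomials, `ring`) tending to `−213` (orders one to six EXACT), and `N r^s → N`.
[cite: BeatonBousquetMelouDeGierDuminilCopinGuttmann2014, Section 3.1, Proposition 5 (arXiv v5 p. 9)] [cite: MadrasSlade1993, Section 4.2, (4.2.4) (p. 91)] -/
theorem tendsto_eighth_order_comparison (m₁ m₂ m₃ m₄ : ℕ) :
    Tendsto (fun y : ℝ => y ^ 6 * ((y / wallRate y ^ 2) ^ 2 - 1) + y ^ 5 * ((y / wallRate y ^ 2) ^ 3 - 1) +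
        y ^ 4 * (3 * (y / wallRate y ^ 2) ^ 4 + (y / wallRate y ^ 2) ^ 5 - 2) +
        y ^ 3 * (6 * (y / wallRate y ^ 2) ^ 5 + 3 * (y / wallRate y ^ 2) ^ 6 - 4) +
        y ^ 2 * (15 * (y / wallRate y ^ 2) ^ 6 + 11 * (y / wallRate y ^ 2) ^ 7 + (y / wallRate y ^ 2) ^ 8 - 6) +
        y * (38 * (y / wallRate y ^ 2) ^ 7 + 34 * (y / wallRate y ^ 2) ^ 8 + 7 * (y / wallRate y ^ 2) ^ 9 - 12) +
        (#((ipwb m₁).filter fun ω => visits m₁ ω = 1) * (y / wallRate y ^ 2) ^ 8 +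
          #((ipwb m₂).filter fun ω => visits m₂ ω = 2) * (y / wallRate y ^ 2) ^ 9 +
          #((ipwb m₃).filter fun ω => visits m₃ ω = 3) * (y / wallRate y ^ 2) ^ 10 +
          #((ipwb m₄).filter fun ω => visits m₄ ω = 4) * (y / wallRate y ^ 2) ^ 11))
      atTop (𝓝 ((#((ipwb m₁).filter fun ω => visits m₁ ω = 1) : ℝ) + #((ipwb m₂).filter fun ω => visits m₂ ω = 2) +
        #((ipwb m₃).filter fun ω => visits m₃ ω = 3) + #((ipwb m₄).filter fun ω => visits m₄ ω = 4) - 213)) := by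
  set N₁ := (#((ipwb m₁).filter fun ω => visits m₁ ω = 1) : ℝ) with hN₁
  set N₂ := (#((ipwb m₂).filter fun ω => visits m₂ ω = 2) : ℝ) with hN₂
  set N₃ := (#((ipwb m₃).filter fun ω => visits m₃ ω = 3) : ℝ) with hN₃
  set N₄ := (#((ipwb m₄).filter fun ω => visits m₄ ω = 4) : ℝ) with hN₄
  have hr := tendsto_div_sq_wallRate_ci
  have hA := tendsto_sq_mul_one_sub_div_wallRate_sq
  have hQ := tendsto_cube_mul_one_sub_div_sub
  have hP := tendsto_pow_four_mul_one_sub_div_sub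
  have hH := tendsto_pow_five_mul_one_sub_div_sub
  have hK := tendsto_pow_six_mul_one_sub_div_sub
  have hu : Tendsto (fun y : ℝ => y⁻¹) atTop (𝓝 0) := tendsto_inv_atTop_zero
  have hN := ((((hr.pow 8).const_mul N₁).add ((hr.pow 9).const_mul N₂)).add ((hr.pow 10).const_mul N₃)).add ((hr.pow 11).const_mul N₄)
  have h0 := ((((((((((((((((((((((((((((((((((hA.pow 2).const_mul (28 : ℝ)).add
      ((hA.mul hQ).const_mul (3 : ℝ))).add
      (hA.const_mul ((-175) : ℝ))).add
      (hQ.pow 2)).add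
      (hQ.const_mul ((-45) : ℝ))).add
      (hP.const_mul ((-15) : ℝ))).add
      (hH.const_mul ((-3) : ℝ))).add
      (hK.const_mul ((-2) : ℝ))).add
      (((hA.pow 3).mul hu).const_mul ((-1) : ℝ))).add
      (((hA.pow 2).mul hu).const_mul (105 : ℝ))).add
      ((hA.mul hu).const_mul ((-601) : ℝ))).add
      (((hA.pow 3).mul (hu.pow 2)).const_mul ((-22) : ℝ))).add
      (((hA.pow 2).mul (hu.pow 2)).const_mul (484 : ℝ))).add
      (((hA.pow 3).mul (hu.pow 3)).const_mul ((-120) : ℝ))).add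
      (((hA.pow 2).mul (hu.pow 3)).const_mul (2002 : ℝ))).add
      (((hA.pow 4).mul (hu.pow 4)).const_mul (8 : ℝ))).add
      (((hA.pow 3).mul (hu.pow 4)).const_mul ((-741) : ℝ))).add
      (((hA.pow 4).mul (hu.pow 5)).const_mul (75 : ℝ))).add
      (((hA.pow 3).mul (hu.pow 5)).const_mul ((-3822) : ℝ))).add
      (((hA.pow 5).mul (hu.pow 6)).const_mul ((-1) : ℝ))).add
      (((hA.pow 4).mul (hu.pow 6)).const_mul (680 : ℝ))).add
      (((hA.pow 5).mul (hu.pow 7)).const_mul ((-24) : ℝ))).add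
      (((hA.pow 4).mul (hu.pow 7)).const_mul (4592 : ℝ))).add
      (((hA.pow 5).mul (hu.pow 8)).const_mul ((-377) : ℝ))).add
      (((hA.pow 6).mul (hu.pow 9)).const_mul (3 : ℝ))).add
      (((hA.pow 5).mul (hu.pow 9)).const_mul ((-3584) : ℝ))).add
      (((hA.pow 6).mul (hu.pow 10)).const_mul (120 : ℝ))).add
      (((hA.pow 6).mul (hu.pow 11)).const_mul (1806 : ℝ))).add
      (((hA.pow 7).mul (hu.pow 12)).const_mul ((-19) : ℝ))).add
      (((hA.pow 7).mul (hu.pow 13)).const_mul ((-562) : ℝ))).add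
      ((hA.pow 8).mul (hu.pow 14))).add
      (((hA.pow 8).mul (hu.pow 15)).const_mul (97 : ℝ))).add
      (((hA.pow 9).mul (hu.pow 17)).const_mul ((-7) : ℝ)))
  have h := h0.add hN
  refine Tendsto.congr' ?_ (tendsto_of_tendsto_of_eq_ci h (by ring))
  filter_upwards [eventually_gt_atTop (0 : ℝ)] with y hy
  have hw : wallRate y ≠ 0 := (wallRate_pos y).ne'
  have hy' : y ≠ 0 := hy.ne'
  field_simp
  ring

/-! ### §6  THE EIGHTH COEFFICIENT IS THE DIAGONAL-EIGHT CENSUS MINUS 213 -/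

open Classical in
/-- ★★★ **THE EIGHTH-ORDER CENSUS IDENTITY.**  As `y → ∞`,
`y⁷ (β(y)² − y − 1/y − 1/y² − 2/y³ − 4/y⁴ − 6/y⁵ − 12/y⁶) → N₉,₁ + N₁₀,₂ + N₁₁,₃ + N₁₂,₄ − 213`,
where `N_{s,v} = #{ω ∈ ipwb (2s) : visits = v}` are the four class numbers of the diagonal `s − v = 8` of the wall-renewal census (symbolic lengths
`m₁ = 18, …, m₄ = 24`): the eighth coefficient of the strong-adsorption expansion of `β²` EXISTS and is an explicit affine function of the census —
the lower half from Kesten's identity over the exactly counted diagonal `s − v ≤ 7` (cars 63–72) plus the four symbolic classes, the upper half from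
the order-eight head sandwich (six-step tail at `n = 13`, crude counts `3ⁿ` on the classes with `s − v ≥ 9`).  With the exhibits of «BLOCKS-EIGHT-A/B»
(`N ≥ 98, 99, 33, 1`) the limit is `≥ 18`; with the kernel census / «SIX-STEP-RIGIDITY» it becomes `a₇ = 18`.
[cite: Kesten1963SAW, Section 4] [cite: MadrasSlade1993, Section 4.2, (4.2.4), Theorem 4.2.2 (pp. 91–92)] [cite: BeatonBousquetMelouDeGierDuminilCopinGuttmann2014, Section 3.1, Proposition 5 (arXiv v5 p. 9); p. 10] -/
theorem tendsto_pow_seven_mul_wallRate_sq_sub_census {m₁ m₂ m₃ m₄ : ℕ} (h₁ : m₁ = 18) (h₂ : m₂ = 20) (h₃ : m₃ = 22) (h₄ : m₄ = 24) :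
    Tendsto (fun y : ℝ => y ^ 7 * (wallRate y ^ 2 - y - 1 / y - 1 / y ^ 2 - 2 / y ^ 3 - 4 / y ^ 4 - 6 / y ^ 5 - 12 / y ^ 6)) atTop
      (𝓝 ((#((ipwb m₁).filter fun ω => visits m₁ ω = 1) : ℝ) + #((ipwb m₂).filter fun ω => visits m₂ ω = 2) +
        #((ipwb m₃).filter fun ω => visits m₃ ω = 3) + #((ipwb m₄).filter fun ω => visits m₄ ω = 4) - 213)) := by
  have hlo := tendsto_eighth_order_comparison m₁ m₂ m₃ m₄
  have hup := hlo.add tendsto_pow_seven_mul_sq_wallRate_mul_tail_eight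
  rw [add_zero] at hup
  refine tendsto_of_tendsto_of_tendsto_of_le_of_le' hlo hup ?_ ?_
  · filter_upwards [eventually_gt_atTop (hexConnectiveConstant ^ 3)] with y hy using (eighth_order_two_sided_of_cube_lt h₁ h₂ h₃ h₄ hy).1
  · filter_upwards [eventually_gt_atTop (hexConnectiveConstant ^ 3)] with y hy using (eighth_order_two_sided_of_cube_lt h₁ h₂ h₃ h₄ hy).2

open Classical in
/-- ★★ Uniqueness form: any limit of `y⁷(β(y)² − y − … − 12/y⁶)` IS the census expression. [cite: MadrasSlade1993, Section 4.2, Theorem 4.2.2 (pp. 91–92)] -/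
theorem eq_census_of_tendsto_pow_seven_mul_wallRate_sq_sub {m₁ m₂ m₃ m₄ : ℕ} (h₁ : m₁ = 18) (h₂ : m₂ = 20) (h₃ : m₃ = 22) (h₄ : m₄ = 24)
    {L : ℝ} (h : Tendsto (fun y : ℝ => y ^ 7 * (wallRate y ^ 2 - y - 1 / y - 1 / y ^ 2 - 2 / y ^ 3 - 4 / y ^ 4 - 6 / y ^ 5 - 12 / y ^ 6)) atTop (𝓝 L)) :
    L = (#((ipwb m₁).filter fun ω => visits m₁ ω = 1) : ℝ) + #((ipwb m₂).filter fun ω => visits m₂ ω = 2) +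
        #((ipwb m₃).filter fun ω => visits m₃ ω = 3) + #((ipwb m₄).filter fun ω => visits m₄ ω = 4) - 213 :=
  tendsto_nhds_unique h (tendsto_pow_seven_mul_wallRate_sq_sub_census h₁ h₂ h₃ h₄)

open Classical in
/-- ★★ **Corollary with the exhibits**: the diagonal-eight census is at least `231`, i.e. `N₉,₁ + N₁₀,₂ + N₁₁,₃ + N₁₂,₄ − 213 ≥ 18`
(«BLOCKS-EIGHT-A/B»: `98 + 99 + 33 + 1`). [cite: MadrasSlade1993, Section 4.2, Definition 4.2.1, (4.2.2)] -/
theorem eighteen_le_census_eight {m₁ m₂ m₃ m₄ : ℕ} (h₁ : m₁ = 18) (h₂ : m₂ = 20) (h₃ : m₃ = 22) (h₄ : m₄ = 24) :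
    (18 : ℝ) ≤ (#((ipwb m₁).filter fun ω => visits m₁ ω = 1) : ℝ) + #((ipwb m₂).filter fun ω => visits m₂ ω = 2) +
        #((ipwb m₃).filter fun ω => visits m₃ ω = 3) + #((ipwb m₄).filter fun ω => visits m₄ ω = 4) - 213 :=
  eighteen_le_of_tendsto_pow_seven_mul_wallRate_sq_sub (tendsto_pow_seven_mul_wallRate_sq_sub_census h₁ h₂ h₃ h₄)

end Literature.Probability.RandomPlanarGeometry.SAW.HexBW.Wall

end
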